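import Mathlib
import Literature.NumberTheory.Irrationality.DirichletLValues.ChowlaMilnorLFunctionProofs
import HarnessLib

/-!
# Holomorphy of `L(s, f)` at `s = 1` and non-vanishing at the integers `k > 1` under the Chowla–Milnor conjecture
# (Gun–Murty–Rath 2011, Proposition 6)

Topic `Literature/NumberTheory/Irrationality/DirichletLValues`. Proofs-only leaf (theorems only, no definition, no
named fact, no `sorry`; cell pub-zeta5, P1 g54), sequel of `ChowlaMilnorLFunctionProofs.lean` (P1 g53:
`chowlaChowla_iff_milnor`, eq. (1)).

## Source (read on the page)

S. Gun, M. R. Murty, P. Rath, *On a conjecture of Chowla and Milnor*, Canad. J. Math. **63** (2011) 1328–1344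
[GunRammurtyRath2011]: p. 1328 «Since `L(s, f) = q^{−s} Σ_{a=1}^{q} f(a)ζ(s, a/q)`, `L(s, f)` extends meromorphically to
the complex plane with a possible simple pole at `s = 1` with residue `q^{−1} Σ_{a=1}^{q} f(a)`»; p. 1342
«**Proposition 6** Suppose that Chowla–Milnor conjecture is true. Then for any non zero rational-valued periodic
function `f` with prime period, `L(s, f)` is holomorphic at `s = 1` implies that it does not vanish at all integers
`k > 1`. *Proof.* Let `f` be as above and `L(k, f) = 0`. Then by the conjecture of Chowla and Milnor, this implies that
`f(1) = f(2) = ⋯ = f(p − 1) = f(p)/(1 − p^k)`. But since `f` is a non-zero function,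
`Σ_{a=1}^{p} f(a) = f(p)(p − 1)/(1 − p^k) + f(p) ≠ 0`. Thus `L(s, f)` has a pole at `s = 1`.»

## What is proved (Mathlib's `ZMod.LFunction Φ`, the meromorphic continuation of `Σ Φ(n) n^{−s}`)

* `sum_eq_zero_of_continuousAt_LFunction_one`, **`differentiableAt_LFunction_one_iff`** — «a possible simple pole at
  `s = 1` with residue `q^{−1}Σ f(a)`», read both ways: `L(·, Φ)` is holomorphic (equivalently continuous) at `s = 1`
  iff `Σ_a Φ(a) = 0` (Mathlib's `ZMod.LFunction_residue_one` and `ZMod.differentiableAt_LFunction`);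
* `linearIndependent_iff_finrank_span_eq_totient` — at a prime `p` the two typings of the conjecture used in the tree
  agree: Milnor's `LinearIndependent ℚ (a ↦ ζ(k, a/p))_{1 ≤ a < p}` (P1 g53) iff `dim_ℚ V_k(p) = φ(p)` (P1 g50–g54);
* **`LFunction_natCast_ne_zero_of_differentiableAt_one`** — PROPOSITION 6, typed at a prime `p` with MILNOR'S
  conjecture at `(k, p)` for the relevant `k` as hypothesis: `f : ℤ/p → ℚ`, `f ≠ 0`, `L(·, f)` holomorphic at `1`,
  `k ≥ 2` ⇒ `L(k, f) ≠ 0`; `LFunction_natCast_ne_zero_of_sum_eq_zero` — the same from `Σ_a f(a) = 0`.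

HONEST FRAMING: a printed CM-conditional implication with the conjecture INLINE as hypothesis, plus the unconditional
residue criterion; the conjectures stay OPEN; nothing here concerns `ζ(5)`.
-/

noncomputable section

open Finset Complex Filter Topology

namespace Literature.NumberTheory.Irrationality.DirichletLValues

open Literature.NumberTheory.Transcendental

/-! ### Holomorphy at `s = 1` ⟺ `Σ Φ = 0` -/

/-- **If `L(·, Φ)` is continuous at `s = 1` then `Σ_a Φ(a) = 0`**: the residue of `L(s, Φ)` at `s = 1` is
`N^{−1} Σ_a Φ(a)` (Mathlib `ZMod.LFunction_residue_one`), and a function continuous at `1` has residue `0` there.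
[cite: GunRammurtyRath2011, p. 1328 («a possible simple pole at s = 1 with residue q^{−1}Σf(a)»)] -/
theorem sum_eq_zero_of_continuousAt_LFunction_one {N : ℕ} [NeZero N] {Φ : ZMod N → ℂ}
    (h : ContinuousAt (ZMod.LFunction Φ) 1) : ∑ j, Φ j = 0 := by
  have h1 : Tendsto (fun s : ℂ => (s - 1) * ZMod.LFunction Φ s) (𝓝[≠] 1) (𝓝 ((1 - 1) * ZMod.LFunction Φ 1)) := by
    have hc : ContinuousAt (fun s : ℂ => (s - 1) * ZMod.LFunction Φ s) 1 :=
      ((continuous_id.sub continuous_const).continuousAt).mul h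
    exact hc.tendsto.mono_left nhdsWithin_le_nhds
  rw [sub_self, zero_mul] at h1
  have h2 := ZMod.LFunction_residue_one Φ
  have heq : (∑ j, Φ j / (N : ℂ)) = 0 := tendsto_nhds_unique h2 h1
  rw [← Finset.sum_div, div_eq_zero_iff] at heq
  rcases heq with h0 | hN
  · exact h0
  · exact absurd hN (by exact_mod_cast NeZero.ne N)

/-- **`L(·, Φ)` is holomorphic at `s = 1` iff `Σ_a Φ(a) = 0`** («extends meromorphically … with a possible simple pole at
`s = 1` with residue `q^{−1}Σ_{a=1}^{q} f(a)`», p. 1328; `⟸` is Mathlib's `ZMod.differentiableAt_LFunction`).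
[cite: GunRammurtyRath2011, p. 1328 (display (1) and the residue at s = 1)] -/
theorem differentiableAt_LFunction_one_iff {N : ℕ} [NeZero N] (Φ : ZMod N → ℂ) :
    DifferentiableAt ℂ (ZMod.LFunction Φ) 1 ↔ ∑ j, Φ j = 0 :=
  ⟨fun h => sum_eq_zero_of_continuousAt_LFunction_one h.continuousAt,
    fun h => ZMod.differentiableAt_LFunction Φ 1 (Or.inr h)⟩

/-! ### The two typings of the conjecture at a prime modulus agree -/

/-- At a prime `p`, the generating set of `V_k(p)` is the range of `a ↦ ζ(k, a/p)` on `1 ≤ a < p`. [folklore] -/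
private theorem generators_prime_eq_range {p : ℕ} [hp : Fact p.Prime] (k : ℕ) :
    {y : ℝ | ∃ a : ℕ, 1 ≤ a ∧ a < p ∧ Nat.Coprime a p ∧ y = hurwitzValue k ((a : ℝ) / p)} =
      Set.range fun a : ↥(Finset.Ico 1 p) => hurwitzValue k (((a : ℕ) : ℝ) / p) := by
  ext y
  simp only [Set.mem_setOf_eq, Set.mem_range, Subtype.exists, Finset.mem_Ico]
  constructor
  · rintro ⟨a, ha1, hap, -, rfl⟩
    exact ⟨a, ⟨ha1, hap⟩, rfl⟩
  · rintro ⟨a, ⟨ha1, hap⟩, rfl⟩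
    exact ⟨a, ha1, hap,
      Nat.Coprime.symm ((Nat.Prime.coprime_iff_not_dvd hp.out).2 (Nat.not_dvd_of_pos_of_lt ha1 hap)), rfl⟩

/-- **Milnor's conjecture at `(k, p)` ⟺ `dim_ℚ V_k(p) = φ(p)`** for a prime `p`: the `p − 1 = φ(p)` numbers `ζ(k, a/p)`,
`1 ≤ a < p`, are `ℚ`-linearly independent iff their span has dimension `φ(p)` — the two typings of the conjecture in
`ChowlaMilnorLFunctionProofs.lean` (`LinearIndependent`) and `ChowlaMilnorOddEvenSplitProofs.lean` (`finrank`).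
[cite: GunRammurtyRath2011, Conjecture (Milnor), Conjecture (Chowla–Milnor), Definition 1 (pp. 1329–1330)] -/
theorem linearIndependent_iff_finrank_span_eq_totient {p : ℕ} [hp : Fact p.Prime] (k : ℕ) :
    (LinearIndependent ℚ fun a : ↥(Finset.Ico 1 p) => hurwitzValue k (((a : ℕ) : ℝ) / p)) ↔
      Module.finrank ℚ ↥(Submodule.span ℚ {y : ℝ | ∃ a : ℕ, 1 ≤ a ∧ a < p ∧ Nat.Coprime a p ∧
        y = hurwitzValue k ((a : ℝ) / p)}) = Nat.totient p := by
  rw [linearIndependent_iff_card_eq_finrank_span, Set.finrank, ← generators_prime_eq_range k,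
    Nat.totient_prime hp.out]
  simp only [Fintype.card_coe, Nat.card_Ico]
  constructor
  · intro h; exact h.symm
  · intro h; exact h.symm

/-! ### Proposition 6 -/

/-- Summing the exceptional function: if `f(a) = f(0)/(1 − p^k)` for all `a ≠ 0` and `Σ_a f(a) = 0`, then `f = 0`
(`p` prime, `k ≥ 2`: «`Σ_{a=1}^{p} f(a) = f(p)(p − 1)/(1 − p^k) + f(p) ≠ 0`» unless `f(p) = 0`).
[cite: GunRammurtyRath2011, proof of Proposition 6 (p. 1342)] -/
private theorem eq_zero_of_exceptional_of_sum_eq_zero {p : ℕ} [hp : Fact p.Prime] {k : ℕ} (hk : 2 ≤ k)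
    {f : ZMod p → ℚ} (hexc : ∀ a : ZMod p, a ≠ 0 → f a = f 0 / (1 - (p : ℚ) ^ k)) (hsum : ∑ a, f a = 0) :
    f = 0 := by
  have hp2 : 2 ≤ p := hp.out.two_le
  have hpk : (1 : ℚ) - (p : ℚ) ^ k ≠ 0 := by
    have h : (1 : ℚ) < (p : ℚ) ^ k := one_lt_pow₀ (by exact_mod_cast hp2) (by omega)
    exact (sub_neg.mpr h).ne
  -- `Σ_a f(a) = f(0) + (p − 1) · f(0)/(1 − p^k)`
  have hsplit : ∑ a, f a = f 0 + ((p : ℚ) - 1) * (f 0 / (1 - (p : ℚ) ^ k)) := by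
    rw [← Finset.add_sum_erase _ _ (Finset.mem_univ (0 : ZMod p))]
    congr 1
    rw [Finset.sum_congr rfl fun a ha => hexc a (Finset.ne_of_mem_erase ha), Finset.sum_const,
      Finset.card_erase_of_mem (Finset.mem_univ _), Finset.card_univ, ZMod.card, nsmul_eq_mul,
      Nat.cast_sub (by omega), Nat.cast_one]
  -- hence `f(0) · (p − p^k) = 0`, so `f(0) = 0`
  have hppk : (p : ℚ) - (p : ℚ) ^ k ≠ 0 := by
    have h : (p : ℚ) < (p : ℚ) ^ k := by
      have := pow_lt_pow_right₀ (by exact_mod_cast hp2 : (1 : ℚ) < p) (by omega : 1 < k)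
      simpa using this
    exact (sub_neg.mpr h).ne
  have hf0 : f 0 = 0 := by
    rw [hsplit] at hsum
    field_simp at hsum
    have : f 0 * ((p : ℚ) - (p : ℚ) ^ k) = 0 := by linear_combination hsum
    exact (mul_eq_zero.1 this).resolve_right hppk
  funext a
  by_cases ha : a = 0
  · rw [ha, hf0]; rfl
  · rw [hexc a ha, hf0, zero_div]; rfl

/-- **Proposition 6, with the hypothesis `Σ_a f(a) = 0`**: at a prime `p`, if Milnor's conjecture holds at `(k, p)`
(`k ≥ 2`), then every non-zero `f : ℤ/p → ℚ` with `Σ_a f(a) = 0` has `L(k, f) ≠ 0` (by `chowlaChowla_iff_milnor` a zero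
forces the exceptional function, whose sum is non-zero). [cite: GunRammurtyRath2011, Proposition 6 and its proof (p. 1342)] -/
theorem LFunction_natCast_ne_zero_of_sum_eq_zero {p : ℕ} [Fact p.Prime] {k : ℕ} (hk : 2 ≤ k)
    (hM : LinearIndependent ℚ fun a : ↥(Finset.Ico 1 p) => hurwitzValue k (((a : ℕ) : ℝ) / p))
    {f : ZMod p → ℚ} (hf : f ≠ 0) (hsum : ∑ a, f a = 0) :
    ZMod.LFunction (fun j => ((f j : ℚ) : ℂ)) k ≠ 0 := by
  intro hL
  have hexc := (chowlaChowla_iff_milnor hk).2 hM f hL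
  exact hf (eq_zero_of_exceptional_of_sum_eq_zero hk hexc hsum)

/-- **Gun–Murty–Rath 2011, Proposition 6** «Suppose that Chowla–Milnor conjecture is true. Then for any non zero
rational-valued periodic function `f` with prime period, `L(s, f)` is holomorphic at `s = 1` implies that it does not
vanish at all integers `k > 1`» — typed at a prime `p` with Milnor's conjecture (= Chowla–Milnor at a prime modulus) at
`(k, p)` for every `k ≥ 2` as hypothesis, «holomorphic at `s = 1`» as `DifferentiableAt ℂ (L(·, f)) 1` for Mathlib's
continuation `ZMod.LFunction`. [cite: GunRammurtyRath2011, Proposition 6 and its proof (p. 1342)] -/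
theorem LFunction_natCast_ne_zero_of_differentiableAt_one {p : ℕ} [Fact p.Prime]
    (hM : ∀ k : ℕ, 2 ≤ k → LinearIndependent ℚ fun a : ↥(Finset.Ico 1 p) => hurwitzValue k (((a : ℕ) : ℝ) / p))
    {f : ZMod p → ℚ} (hf : f ≠ 0) (hhol : DifferentiableAt ℂ (ZMod.LFunction fun j => ((f j : ℚ) : ℂ)) 1)
    {k : ℕ} (hk : 2 ≤ k) :
    ZMod.LFunction (fun j => ((f j : ℚ) : ℂ)) k ≠ 0 := by
  have hsumC := (differentiableAt_LFunction_one_iff _).1 hhol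
  have hsum : ∑ a, f a = 0 := by exact_mod_cast hsumC
  exact LFunction_natCast_ne_zero_of_sum_eq_zero hk (hM k hk) hf hsum

end Literature.NumberTheory.Irrationality.DirichletLValues

end
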